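/-
Copyright: derived here (Resolution Observatory cell `pub-rosobs`, carver gen 58). AI-written Lean; AI review is weaker than expert
review.  The closing step of engine 1's THEOREM LT (THEOREM-LT-eng1-g38 §3 (b)–(c); carver target T59) for the cell's POLYNOMIAL
weighted-centre model `W(f)`.  Instrument — NOT a resolution theorem and NOT a statement about the invariant of
[AbramovichTemkinWlodarczyk2024].
-/
import Mathlib.Algebra.MvPolynomial.Supported
import Mathlib.Algebra.MvPolynomial.CommRing
import Mathlib.RingTheory.Derivation.Basic
import Mathlib.Data.Finset.Card
import HarnessLib

/-!
# Triangular constants: a derivation killing a unitriangular family of coordinates is zero (THEOREM LT, closing step)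

Uniform value line: INSTRUMENT — kernel-checked commutative algebra for engine 1's THEOREM LT (THEOREM-LT-eng1-g38 §3) in the cell's
polynomial weighted-centre model `W(f)`; NOT a resolution theorem, NOT a statement about the Abramovich–Temkin–Włodarczyk invariant,
NOT summit progress, and NOT a proof of LEMMA K, LEMMA LL or of the induction §3 (b) itself; AI-written Lean, AI review is weaker
than expert review.

## What THEOREM LT §3 (b)–(c) needs, and what is typed here

The induction of THEOREM LT treats the weight classes from the top; for the class `C` under treatment LEMMA LL produces
`m_f ∈ k[ε_LIGHT]` (the slots LIGHTER than `C`, which have not been touched yet and never will be touched by a later step except through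
their own corrections) with `D ε_f = D(m_f)`, and passes to `ε'_f := ε_f − m_f`.  Since `D`-constancy is a property of ring ELEMENTS,
at the end one holds, in the ORIGINAL variables, a family

  `e_i := X_i − m_i`,  `m_i ∈ k[X_j : w_j < w_i]`,  `D e_i = 0`  for every slot `i`

(`m_i = 0` on the classes that are `D`-constant for free, §3 (a), and on the heavy `D`-constant classes).  Step (c) of the notes —
"a derivation vanishing on a generating set is `0`" — needs that such a UNITRIANGULAR family generates the polynomial ring.  This file
proves exactly that, over any commutative ring of coefficients and any index type:

* §1 `adjoin_eq_top_of_rank_lt` — if every `m_i` only involves variables of rank `< rk i` (`rk : σ → ℕ`), then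
  `Algebra.adjoin R {X_i − m_i} = ⊤` (induction on the rank: `X_i = (X_i − m_i) + m_i` with `m_i` already reached);
  `adjoin_eq_top_of_weight_lt` — the same with a weight function `w : σ → W` into any preorder on a FINITE slot set
  (rank `:= #{j | w_j < w_i}`, `rank_lt_of_weight_lt`; no new definitions).
* §2 `derivation_eq_zero_of_rank_lt` / **`derivation_eq_zero_of_weight_lt`** — a derivation `D` (into any module) with
  `D(X_i) = D(m_i)` for such a family is `0` (Mathlib `Derivation.ext_of_adjoin_eq_top`); the `∃`-form
  `derivation_eq_zero_of_exists_lighter` is THEOREM LT's conclusion "`D = 0`" from the per-class outputs of LEMMA LL.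
* §3 `apply_eq_zero_iff_of_weight_lt` — uniqueness phrasing: two derivations that agree on such a family agree.

NOT here: the automorphism `X_i ↦ X_i − m_i` itself (ALREADY in the tree: `WeightedBlowup.triangularEquiv` / `blockShear`,
`WeightedCentreNoPureTranslation` §1 / `WeightedCentreConjugation`), LEMMA K (`PinFamily`), LEMMA LL (`DerivationLayers`, `LTKit`),
the weight bookkeeping of §3 (a) (`isWeightedHomogeneous_eq_zero_of_weight_lt`, `WeightedCentreSecondClassGap`).

References: [Lang2002] Ch. XIX §3 (derivations are determined by their values on algebra generators); the unitriangular
("de Jonquières") substitutions `X_i ↦ X_i + m_i(X_{<i})` and that they are automorphisms [cite: VandenessenKurodaCrachiola2021, Ch. 3];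
context [AbramovichTemkinWlodarczyk2024] §5 (weights of a weighted centre).
-/

open MvPolynomial

namespace Literature.AlgebraicGeometry.Resolution.WeightedBlowup

namespace TriangularConstants

variable {R : Type*} [CommRing R] {σ : Type*}

/-! ## §1 Unitriangular families generate the polynomial ring -/

section Generate

/-- **A unitriangular family generates.**  If every correction `m_i` only involves variables of rank `< rk i`, then the
elements `X_i − m_i` generate `R[X_σ]` as an `R`-algebra (induction on the rank: `X_i = (X_i − m_i) + m_i`, and `m_i` lies in the
subalgebra generated by the lower variables, already reached).  (derived here; the de Jonquières / unitriangular shape)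
[cite: VandenessenKurodaCrachiola2021, Ch. 3] -/
theorem adjoin_eq_top_of_rank_lt (rk : σ → ℕ) (m : σ → MvPolynomial σ R)
    (hm : ∀ i, m i ∈ supported R {j | rk j < rk i}) :
    Algebra.adjoin R (Set.range fun i => X i - m i) = ⊤ := by
  set T : Subalgebra R (MvPolynomial σ R) := Algebra.adjoin R (Set.range fun i => X i - m i) with hT
  have he : ∀ i, X i - m i ∈ T := fun i => Algebra.subset_adjoin ⟨i, rfl⟩
  have hX : ∀ n i, rk i = n → (X i : MvPolynomial σ R) ∈ T := by
    intro n
    induction n using Nat.strong_induction_on with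
    | _ n ih =>
      intro i hi
      have hmi : m i ∈ T := by
        refine (Algebra.adjoin_le ?_ : supported R {j | rk j < rk i} ≤ T) (hm i)
        rintro _ ⟨j, hj, rfl⟩
        exact ih (rk j) (hi ▸ hj) j rfl
      have : (X i : MvPolynomial σ R) = (X i - m i) + m i := by ring
      rw [this]
      exact T.add_mem (he i) hmi
  rw [eq_top_iff, ← MvPolynomial.adjoin_range_X]
  exact Algebra.adjoin_le (by rintro _ ⟨i, rfl⟩; exact hX (rk i) i rfl)

variable [Fintype σ] {W : Type*} [Preorder W] [DecidableRel (α := W) (· < ·)]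

/-- The rank of a slot for a weight function on a finite slot set — the number `#{j | w j < w i}` of strictly lighter slots —
is strictly monotone in the weight (the lighter slot itself is counted for `i` and not for `j`). (derived here)
[cite: AbramovichTemkinWlodarczyk2024, §5] -/
theorem rank_lt_of_weight_lt (w : σ → W) {i j : σ} (h : w j < w i) :
    (Finset.univ.filter fun l => w l < w j).card < (Finset.univ.filter fun l => w l < w i).card := by
  apply Finset.card_lt_card
  rw [Finset.ssubset_iff_of_subset]
  · refine ⟨j, ?_, ?_⟩
    · simp [h]
    · simp
  · intro l hl
    simp only [Finset.mem_filter, Finset.mem_univ, true_and] at hl ⊢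
    exact lt_trans hl h

/-- **Weight form.**  If every `m_i` only involves slots STRICTLY LIGHTER than `i` (for a weight function into any preorder, on a
finite slot set), then the `X_i − m_i` generate `R[X_σ]` — the final coordinates `ε''_i = ε_i − m_i` of THEOREM LT §3 (c) form a
generating set. (derived here) [cite: VandenessenKurodaCrachiola2021, Ch. 3] -/
theorem adjoin_eq_top_of_weight_lt (w : σ → W) (m : σ → MvPolynomial σ R)
    (hm : ∀ i, (↑(m i).vars : Set σ) ⊆ {j | w j < w i}) :
    Algebra.adjoin R (Set.range fun i => X i - m i) = ⊤ := by
  refine adjoin_eq_top_of_rank_lt (fun i => (Finset.univ.filter fun l => w l < w i).card) m fun i => ?_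
  rw [mem_supported]
  intro j hj
  exact rank_lt_of_weight_lt w (hm i hj)

end Generate

/-! ## §2 A derivation killing a unitriangular family is zero (THEOREM LT §3 (c)) -/

section Derivations

variable {M : Type*} [AddCommGroup M] [Module R M] [Module (MvPolynomial σ R) M]

/-- **Rank form.**  A derivation with `D(X_i) = D(m_i)` for a unitriangular family (`m_i` in the variables of rank `< rk i`) is
`0`: it vanishes on the generating set `{X_i − m_i}`. (derived here) [cite: Lang2002, Ch. XIX §3] -/
theorem derivation_eq_zero_of_rank_lt (rk : σ → ℕ) (D : Derivation R (MvPolynomial σ R) M) (m : σ → MvPolynomial σ R)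
    (hm : ∀ i, m i ∈ supported R {j | rk j < rk i}) (hD : ∀ i, D (X i) = D (m i)) : D = 0 := by
  refine Derivation.ext_of_adjoin_eq_top _ (adjoin_eq_top_of_rank_lt rk m hm) ?_
  rintro _ ⟨i, rfl⟩
  rw [map_sub, hD i, sub_self, Derivation.zero_apply]

variable [Fintype σ] {W : Type*} [Preorder W] [DecidableRel (α := W) (· < ·)]

/-- **THEOREM LT, closing step** (THEOREM-LT-eng1-g38 §3 (c)).  Let `w` be a weight function on a finite slot set and let `D` be a
derivation of `R[X_σ]` (into any module).  If for EVERY slot `i` there is a correction `m_i` involving only strictly lighter slots with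
`D(X_i) = D(m_i)` — `m_i = 0` on the classes that are `D`-constant for free or by hypothesis, and the LEMMA-LL output on the
linearised classes — then `D = 0`. (derived here) [cite: Lang2002, Ch. XIX §3] -/
theorem derivation_eq_zero_of_weight_lt (w : σ → W) (D : Derivation R (MvPolynomial σ R) M) (m : σ → MvPolynomial σ R)
    (hm : ∀ i, (↑(m i).vars : Set σ) ⊆ {j | w j < w i}) (hD : ∀ i, D (X i) = D (m i)) : D = 0 := by
  refine Derivation.ext_of_adjoin_eq_top _ (adjoin_eq_top_of_weight_lt w m hm) ?_
  rintro _ ⟨i, rfl⟩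
  rw [map_sub, hD i, sub_self, Derivation.zero_apply]

/-- `∃`-form of the closing step: it is enough that each slot ADMITS some strictly-lighter correction `m_i` with `D(X_i) = D(m_i)`
(the per-class conclusion of LEMMA LL; `m_i := 0` for a `D`-constant slot). (derived here) [cite: Lang2002, Ch. XIX §3] -/
theorem derivation_eq_zero_of_exists_lighter (w : σ → W) (D : Derivation R (MvPolynomial σ R) M)
    (h : ∀ i, ∃ mi : MvPolynomial σ R, (↑mi.vars : Set σ) ⊆ {j | w j < w i} ∧ D (X i) = D mi) : D = 0 := by
  choose m hm hD using h
  exact derivation_eq_zero_of_weight_lt w D m hm hD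

/-- The dichotomy phrasing of THEOREM LT §3: every slot is either `D`-constant (`D(X_i) = 0`: the free classes of §3 (a) and the
heavy classes) or linearised (`D(X_i) = D(m_i)`, `m_i` strictly lighter); then `D = 0`. (derived here) [cite: Lang2002, Ch. XIX §3] -/
theorem derivation_eq_zero_of_constant_or_linearised (w : σ → W) (D : Derivation R (MvPolynomial σ R) M)
    (h : ∀ i, D (X i) = 0 ∨ ∃ mi : MvPolynomial σ R, (↑mi.vars : Set σ) ⊆ {j | w j < w i} ∧ D (X i) = D mi) : D = 0 := by
  refine derivation_eq_zero_of_exists_lighter w D fun i => ?_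
  rcases h i with h0 | ⟨mi, hmi, hDi⟩
  · exact ⟨0, by simp, by rw [h0, map_zero]⟩
  · exact ⟨mi, hmi, hDi⟩

end Derivations

/-! ## §3 Uniqueness phrasing -/

section Uniqueness

variable {M : Type*} [AddCommGroup M] [Module R M] [Module (MvPolynomial σ R) M] [Fintype σ] {W : Type*} [Preorder W] [DecidableRel (α := W) (· < ·)]

/-- Two derivations that agree on a unitriangular family `X_i − m_i` agree everywhere (so the values `D(ε''_i)` on the final
coordinates of THEOREM LT determine `D`). (derived here) [cite: Lang2002, Ch. XIX §3] -/
theorem derivation_ext_of_weight_lt (w : σ → W) (D₁ D₂ : Derivation R (MvPolynomial σ R) M) (m : σ → MvPolynomial σ R)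
    (hm : ∀ i, (↑(m i).vars : Set σ) ⊆ {j | w j < w i}) (h : ∀ i, D₁ (X i - m i) = D₂ (X i - m i)) : D₁ = D₂ := by
  refine Derivation.ext_of_adjoin_eq_top _ (adjoin_eq_top_of_weight_lt w m hm) ?_
  rintro _ ⟨i, rfl⟩
  exact h i

end Uniqueness

end TriangularConstants

end Literature.AlgebraicGeometry.Resolution.WeightedBlowup
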